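import Summits.CriticalPhenomena.PercolationContinuityZ3.Theorems.PercNearOneGluingNoHeavyLowerTailSahiCombTriWCorCore

/-!
# Small toolkit for P5's correlation form `Cor_P`: sum form, additivity, self-dual value; additivity of `ptVal`

Support file of the one-cut programme (crux `NoHeavyLowerTail`, stmt-CriticalPhenomena-4575; TRI lane of cell `prim-masterthm`; seat prim-lf-1 gen 40,
memo `FROM-prim-lf-1-gen40-CYLINDER-AND-JSWITCH.md`).  Continuation of `…SahiCombTriWCorNonneg` (P5 gen 24: `corP`, `two_mul_corP_of_selfDual`), `…TriWCoatoms` (`corP_eq_sum`) and `…TriWCorCore` (`corP_comm`).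
Used by the stratum files `…SahiCombTriWPerfectMinus`, `…SahiCombTriWPrincipalCor`, `…SahiCombTriWTwoGen` of this generation.

* `corP_erase`, `corP_union`, `corP_singleton_univ` : additivity of `Cor` (with P5's `corP_eq_sum`, `corP_comm`);
* `corP_univ_eq` : `Cor_W(A,B) = 2·(#(A∩B) − #(A∩refl B))`;  `corP_selfDual_eq` : for self-dual `S`, `Cor_S(A,B) = #(A∩B) − #(A∩refl B)` (Kleitman's gap);
* `ptVal_add` : `ptVal` is additive in the point weight.
HONEST LABEL: bookkeeping identities, complete proofs, std axioms. [this work]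
-/

namespace Summit.CriticalPhenomena.PercolationContinuityZ3.Theorems

namespace FiveUpSet

open Finset

variable {β γ : Type} [DecidableEq β] [Fintype β] [DecidableEq γ] [Fintype γ]

omit [DecidableEq β] [Fintype β] in
/-- Removing one point: `Cor_{P.erase z} = Cor_P − ([z∈A]−[zᶜ∈A])([z∈B]−[zᶜ∈B])`. [this work] -/
theorem corP_erase {P : Finset (Finset γ)} {z : Finset γ} (hz : z ∈ P) (A B : Finset (Finset γ)) :
    corP (P.erase z) A B = corP P A B - sgnDiff A (refl A) z * sgnDiff B (refl B) z := by
  rw [corP_eq_sum, corP_eq_sum, ← Finset.add_sum_erase P _ hz]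
  ring

omit [DecidableEq β] [Fintype β] in
/-- `Cor_W(A,B) = 2·(#(A∩B) − #(A ∩ refl B))` (twice Kleitman's gap). [this work] -/
theorem corP_univ_eq (A B : Finset (Finset γ)) : corP univ A B = 2 * (((A ∩ B).card : ℤ) - (A ∩ refl B).card) := by
  unfold corP
  simp only [univ_inter]
  have h1 : (refl A ∩ refl B).card = (A ∩ B).card := by rw [← refl_inter, card_refl]
  have h2 : (refl A ∩ B).card = (A ∩ refl B).card := by rw [← card_refl (refl A ∩ B), refl_inter, refl_refl]
  rw [h1, h2]
  ring

omit [DecidableEq β] [Fintype β] in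
/-- For a self-dual `S`: `Cor_S(A,B) = #(A∩B) − #(A ∩ refl B)`. [this work] -/
theorem corP_selfDual_eq {S : Finset (Finset γ)} (hsd : ∀ u : Finset γ, uᶜ ∈ S ↔ u ∉ S) (A B : Finset (Finset γ)) :
    corP S A B = ((A ∩ B).card : ℤ) - (A ∩ refl B).card := by
  have h := two_mul_corP_of_selfDual hsd A B
  rw [corP_univ_eq] at h
  linarith

omit [DecidableEq β] [Fintype β] in
/-- `ptVal` is additive in the weight. [this work] -/
theorem ptVal_add (κ₁ κ₂ : Finset γ → Finset γ → ℕ) (A B : Finset (Finset γ)) :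
    ptVal (fun u e => κ₁ u e + κ₂ u e) A B = ptVal κ₁ A B + ptVal κ₂ A B := by
  unfold ptVal
  rw [← Finset.sum_add_distrib]
  refine Finset.sum_congr rfl fun u _ => ?_
  rw [← Finset.sum_add_distrib]
  refine Finset.sum_congr rfl fun e _ => ?_
  push_cast
  ring

omit [DecidableEq β] [Fintype β] in
/-- `Cor` is additive: `Cor_{X∪Y} = Cor_X + Cor_Y − Cor_{X∩Y}`. [this work] -/
theorem corP_union (X Y A B : Finset (Finset γ)) : corP (X ∪ Y) A B = corP X A B + corP Y A B - corP (X ∩ Y) A B := by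
  rw [corP_eq_sum, corP_eq_sum, corP_eq_sum, corP_eq_sum, ← Finset.sum_union_inter]
  ring

omit [DecidableEq β] [Fintype β] in
/-- `Cor_{{univ}}(A,B) = δ_A(univ)·δ_B(univ)`. [this work] -/
theorem corP_singleton_univ (A B : Finset (Finset γ)) :
    corP {univ} A B = sgnDiff A (refl A) univ * sgnDiff B (refl B) univ := by
  rw [corP_eq_sum, sum_singleton]

end FiveUpSet

end Summit.CriticalPhenomena.PercolationContinuityZ3.Theorems
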